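import Mathlib
import Summits.ResolutionOfSingularities.ResolutionOfSingularities.Theorems.WildQuotientsWildQuotientResolutionPeelingFrameGluedCharts
import Summits.ResolutionOfSingularities.ResolutionOfSingularities.Theorems.WildQuotientsWildQuotientResolutionAffineQuotientBlowupModel

/-!
# Peeling frame: Bergh–Rydh charts on the pieces of an affine quotient MODEL `V/G → Spec B^G`

(crux stmt-ResolutionOfSingularities-15640 `WildQuotients.WildQuotientResolution`, S1 = stmt-…-17941; ℤ9
SPECIMEN brick Z6 of res-L1-w45c-idea-2's `cardP_g12/Z9-SPECIMEN.md` §4 (variant V-BR), res-L1-w45c-plan-1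
GO 2026-08-27T16:29:20Z «Z6 = stub-1». [OURS · L1 W4.5c] — assembly of landed decls; NOT a statement of any
manuscript; CONDITIONAL on `BerghRydh2019_diagonalizableQuotientResolution`. Prover res-L1-w45c-stub-1.)

`PeelingFrame.hasResolution_glued_of_pieceGradedCharts_of_berghRydh` (p554757) needs `V/G = ρB.glued`
integral and `V/G → Spec B^G → Spec k` separated, quasi-compact, locally of finite type. In the MODEL
situation of G2/G2b (`AffineQuotient.hasResolution_spec_fixedPoints_of_model`: `B` a finite-type domain
with a faithful `G`-action, `π : V → Spec B` proper birational, `V` integral, `ρB` an action over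
`V → Spec B → Spec B^G` compatible with `π`, stable affine pieces covering `V`) these follow from
`QuotientModel.quotientModel_proper_birational` (`V/G` integral, `V/G → Spec B^G` PROPER). Hence:

* `hasResolution_glued_model_of_pieceGradedCharts` — the `hres : HasResolution ρB.glued` of G2/G2b from
  per-piece graded chart data (`hchart` of p554757) — `B`-letters;
* `hasResolution_glued_liftAction_of_pieceGradedCharts` — the same in the G2b letters
  (`V = affineBlowup I`, `π = affineBlowup.π I`, `hρB : ρB.aut = liftAction ρ hJ`, `G ≤ AlgAut k[x]`), i.e.
  exactly the `hres` slot of `Z9Peeled.hasResolution_of_glued` (res-L1-w45c-stub-3, p555061) and of the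
  O8/O9 finals.
-/

-- single-problem summit: the doubled namespace component `ResolutionOfSingularities` is forced
set_option linter.dupNamespace false

noncomputable section

open CategoryTheory Limits AlgebraicGeometry TopologicalSpace
open scoped Pointwise
open Literature.AlgebraicGeometry.Resolution Literature.AlgebraicGeometry.RelativeSpec

namespace Summit.ResolutionOfSingularities.ResolutionOfSingularities.Theorems.WildQuotientResolution.PeelingFrame

/-- **Z6, model form (`B`-letters).** In the situation of G2 (`B` a finite-type `k`-domain of positive
dimension with a faithful action of the finite group `G`, `π : V → Spec B` proper birational with `V`
integral, `ρB` an action of `G` on `V` over `Spec B^G` compatible with `π`, stable affine pieces covering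
`V`), `k` perfect: per-piece graded REGULAR chart data for a covering family `Pc` of pieces give
`HasResolution (V/G)`. CONDITIONAL on `BerghRydh2019_diagonalizableQuotientResolution`.
[OURS · L1 W4.5c] [cite: BerghRydh2019, Thm 5 (arXiv:1905.00872, p. 4)] -/
theorem hasResolution_glued_model_of_pieceGradedCharts
    (hBR : BerghRydh2019_diagonalizableQuotientResolution)
    (k : Type) [Field k] [PerfectField k] {B : Type} [CommRing B]
    [IsDomain B] [Algebra k B] [Algebra.FiniteType k B] {G : Type} [Group G] [Finite G]
    [MulSemiringAction G B] [SMulCommClass G k B] [FaithfulSMul G B]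
    (hdim : ¬ topologicalKrullDim (Spec (CommRingCat.of B)) ≤ 0)
    (ρ : G →* Aut (Spec (CommRingCat.of B)))
    (hρ : ∀ g : G, (ρ g).hom =
      Spec.map (CommRingCat.ofHom ((MulSemiringAction.toRingEquiv G B g⁻¹ : B ≃+* B) : B →+* B)))
    (V : Scheme.{0}) (π : V ⟶ Spec (CommRingCat.of B)) [IsProper π] (hbir : IsBirational π)
    [IsIntegral V]
    (ρB : ActionOver (π ≫ Spec.map (CommRingCat.ofHom
      (algebraMap (FixedPoints.subalgebra k B G) B))) G)
    (hequiv : ∀ g : G, (ρB.aut g).hom ≫ π = π ≫ (ρ g).hom)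
    (hcov : ∀ v : V, ∃ O : ρB.StableAffineOpens, v ∈ O.1)
    {ι : Type*} (Pc : ι → ρB.StableAffineOpens) (hPc : ∀ x : V, ∃ i, x ∈ (Pc i).1)
    (hchart : ∀ i, ∃ (A : Type) (_ : AddCommGroup A) (_ : Finite A) (_ : DecidableEq A)
      (S : Type) (_ : CommRing S) (_ : Algebra k S) (𝒮 : A → Submodule k S) (_ : GradedAlgebra 𝒮),
      Algebra.FiniteType k S ∧ IsRegularRing S ∧
      ∃ e : ↥(𝒮 0) ≃+* ↥((ρB.restrict (Pc i).1 (Pc i).2.1).invariants.ring ⊤),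
        ∀ c : k, ((e (algebraMap k (𝒮 0) c) :
            ↥((ρB.restrict (Pc i).1 (Pc i).2.1).invariants.ring ⊤)) :
              Γ((Pc i).1, ((Pc i).1.ι ≫ (π ≫ Spec.map (CommRingCat.ofHom
                (algebraMap (FixedPoints.subalgebra k B G) B)))) ⁻¹ᵁ ⊤)) =
          ((Pc i).1.ι ≫ (π ≫ Spec.map (CommRingCat.ofHom
            (algebraMap (FixedPoints.subalgebra k B G) B)))).app ⊤
            (((Spec.map (CommRingCat.ofHom (algebraMap k (FixedPoints.subalgebra k B G)))).appLE ⊤ ⊤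
              le_top) ((Scheme.ΓSpecIso (.of k)).inv c))) :
    Scheme.HasResolution ρB.glued := by
  haveI : LocallyOfFiniteType (Spec.map (CommRingCat.ofHom
      (algebraMap k (FixedPoints.subalgebra k B G)))) :=
    AffineQuotient.locallyOfFiniteType_specMap_fixedPoints k
  haveI : IsFinite (Spec.map (CommRingCat.ofHom (algebraMap (FixedPoints.subalgebra k B G) B))) :=
    AffineQuotient.isFinite_specMap_fixedPoints k
  have hsurj : Function.Surjective
      (Spec.map (CommRingCat.ofHom (algebraMap (FixedPoints.subalgebra k B G) B))).base :=
    AffineQuotient.surjective_specMap_fixedPoints k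
  have horb : ∀ x y : Spec (CommRingCat.of B),
      (Spec.map (CommRingCat.ofHom (algebraMap (FixedPoints.subalgebra k B G) B))).base x =
        (Spec.map (CommRingCat.ofHom (algebraMap (FixedPoints.subalgebra k B G) B))).base y →
      ∃ g : G, (ρ g).hom.base x = y :=
    fun x y hxy => AffineQuotient.exists_specAction_base_eq k ρ hρ x y hxy
  have hfaith : Function.Injective ρ := AffineQuotient.specAction_injective ρ hρ
  have hU := AffineQuotient.exists_dense_etale_specMap_fixedPoints k (B := B) (G := G)
  have hdim' : ¬ topologicalKrullDim (Spec (CommRingCat.of (FixedPoints.subalgebra k B G))) ≤ 0 := by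
    rw [AffineQuotient.topologicalKrullDim_spec_fixedPoints k]; exact hdim
  obtain ⟨hint, hproper, -⟩ := QuotientModel.quotientModel_proper_birational k (Spec (CommRingCat.of B))
    (Spec (CommRingCat.of (FixedPoints.subalgebra k B G)))
    (Spec.map (CommRingCat.ofHom (algebraMap k (FixedPoints.subalgebra k B G))))
    (Spec.map (CommRingCat.ofHom (algebraMap (FixedPoints.subalgebra k B G) B)))
    G ρ hfaith hdim' hsurj hU horb V π hbir ρB hequiv hcov
  haveI := hint
  haveI := hproper
  -- the structure morphism `V/G → Spec B^G → Spec k` is separated, quasi-compact, locally of finite type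
  haveI : IsSeparated (ρB.gluedDesc _ ρB.aut_comp ≫
      Spec.map (CommRingCat.ofHom (algebraMap k (FixedPoints.subalgebra k B G)))) := inferInstance
  haveI : QuasiCompact (ρB.gluedDesc _ ρB.aut_comp ≫
      Spec.map (CommRingCat.ofHom (algebraMap k (FixedPoints.subalgebra k B G)))) := inferInstance
  haveI : LocallyOfFiniteType (ρB.gluedDesc _ ρB.aut_comp ≫
      Spec.map (CommRingCat.ofHom (algebraMap k (FixedPoints.subalgebra k B G)))) := inferInstance
  exact hasResolution_glued_of_pieceGradedCharts_of_berghRydh hBR ρB k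
    (Spec.map (CommRingCat.ofHom (algebraMap k (FixedPoints.subalgebra k B G)))) hcov Pc hPc hchart

/-- **Z6, G2b letters** (`V = Bl_I 𝔸ⁿ`, `π = affineBlowup.π I`, `G ≤ Aut_k k[x]` finite, the lifted action
`hρB : ρB.aut = liftAction ρ hJ`): per-piece graded REGULAR chart data for a covering family of pieces give
the `hres : HasResolution ρB.glued` of `AffineQuotient.hasResolution_mvPolynomial_fixedPoints_of_liftAction_glued`
(and of `Z9Peeled.hasResolution_of_glued`). CONDITIONAL on `BerghRydh2019_diagonalizableQuotientResolution`.
[OURS · L1 W4.5c] [cite: BerghRydh2019, Thm 5 (arXiv:1905.00872, p. 4)] -/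
theorem hasResolution_glued_liftAction_of_pieceGradedCharts
    (hBR : BerghRydh2019_diagonalizableQuotientResolution)
    (k : Type) [Field k] [PerfectField k] (n : ℕ) (hn : 0 < n)
    (G : Subgroup (MvPolynomial (Fin n) k ≃ₐ[k] MvPolynomial (Fin n) k)) [Finite G]
    (ρ : G →* Aut (Spec (CommRingCat.of (MvPolynomial (Fin n) k))))
    (hρ : ∀ g : G, (ρ g).hom = Spec.map (CommRingCat.ofHom
      ((MulSemiringAction.toRingEquiv G (MvPolynomial (Fin n) k) g⁻¹ :
        MvPolynomial (Fin n) k ≃+* MvPolynomial (Fin n) k) :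
          MvPolynomial (Fin n) k →+* MvPolynomial (Fin n) k)))
    (I : Ideal (MvPolynomial (Fin n) k)) (hI : I ≠ ⊥)
    (hJ : ∀ g : G, (affineBlowup.idealSheaf I).comap (ρ g).hom = affineBlowup.idealSheaf I)
    (ρB : ActionOver (affineBlowup.π I ≫ Spec.map (CommRingCat.ofHom
      (algebraMap (FixedPoints.subalgebra k (MvPolynomial (Fin n) k) G) (MvPolynomial (Fin n) k)))) G)
    (hρB : ρB.aut = (affineBlowup.isBlowup I).liftAction ρ hJ)
    (hcov : ∀ v : ↥(affineBlowup I), ∃ O : ρB.StableAffineOpens, v ∈ O.1)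
    {ι : Type*} (Pc : ι → ρB.StableAffineOpens) (hPc : ∀ x : ↥(affineBlowup I), ∃ i, x ∈ (Pc i).1)
    (hchart : ∀ i, ∃ (A : Type) (_ : AddCommGroup A) (_ : Finite A) (_ : DecidableEq A)
      (S : Type) (_ : CommRing S) (_ : Algebra k S) (𝒮 : A → Submodule k S) (_ : GradedAlgebra 𝒮),
      Algebra.FiniteType k S ∧ IsRegularRing S ∧
      ∃ e : ↥(𝒮 0) ≃+* ↥((ρB.restrict (Pc i).1 (Pc i).2.1).invariants.ring ⊤),
        ∀ c : k, ((e (algebraMap k (𝒮 0) c) :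
            ↥((ρB.restrict (Pc i).1 (Pc i).2.1).invariants.ring ⊤)) :
              Γ((Pc i).1, ((Pc i).1.ι ≫ (affineBlowup.π I ≫ Spec.map (CommRingCat.ofHom
                (algebraMap (FixedPoints.subalgebra k (MvPolynomial (Fin n) k) G)
                  (MvPolynomial (Fin n) k))))) ⁻¹ᵁ ⊤)) =
          ((Pc i).1.ι ≫ (affineBlowup.π I ≫ Spec.map (CommRingCat.ofHom
            (algebraMap (FixedPoints.subalgebra k (MvPolynomial (Fin n) k) G)
              (MvPolynomial (Fin n) k))))).app ⊤
            (((Spec.map (CommRingCat.ofHom (algebraMap k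
              (FixedPoints.subalgebra k (MvPolynomial (Fin n) k) G)))).appLE ⊤ ⊤ le_top)
              ((Scheme.ΓSpecIso (.of k)).inv c))) :
    Scheme.HasResolution ρB.glued := by
  haveI := AffineQuotient.faithfulSMul_subgroup_algEquiv k n G
  haveI : IsIntegral (affineBlowup I) := affineBlowup.isIntegral hI
  have hdim : ¬ topologicalKrullDim (Spec (CommRingCat.of (MvPolynomial (Fin n) k))) ≤ 0 := by
    rw [AffineQuotient.topologicalKrullDim_spec_mvPolynomial k n]
    have hn' : (0 : WithBot ℕ∞) < (n : WithBot ℕ∞) := by exact_mod_cast hn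
    exact not_le.mpr hn'
  have hequiv : ∀ g : G, (ρB.aut g).hom ≫ affineBlowup.π I = affineBlowup.π I ≫ (ρ g).hom := by
    intro g
    rw [hρB]
    exact (affineBlowup.isBlowup I).liftAction_hom_comp ρ hJ g
  exact hasResolution_glued_model_of_pieceGradedCharts hBR k hdim ρ hρ (affineBlowup I)
    (affineBlowup.π I) (affineBlowup.isBirational hI) ρB hequiv hcov Pc hPc hchart

end Summit.ResolutionOfSingularities.ResolutionOfSingularities.Theorems.WildQuotientResolution.PeelingFrame

end
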